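import Mathlib
import Literature.NumberTheory.LFunctions.SuzukiCanonicalSystem
import Literature.NumberTheory.LFunctions.SuzukiSingleOperatorKernelProofs
import Summits.RiemannHypothesis.RiemannHypothesis.Theorems.SuzukiHSWindow
import Summits.RiemannHypothesis.RiemannHypothesis.Theorems.SuzukiWindowsDoorGalerkinWindow
import HarnessLib

/-!
# Bessel's equality for the Galerkin remainder, and the window certificate «as certified» (RH-free, K-general)

Companion of `SuzukiWindowsDoorGalerkinWindow` (the kernel-checked logic of the rh-dbr ET1b/ET1c op-norm window
certificates).  There the finite-rank remainder `D(x,y) = K(x+y) − Σᵢⱼ Mᵢⱼ φᵢ(x)φⱼ(y)` enters through the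
hypothesis `∫_S∫_S D² ≤ δ²`.  The engine does not integrate `D²`: it certifies the Hilbert–Schmidt integral
`h = ∫_S∫_S K(x+y)²` and the Galerkin matrix `Mᵢⱼ = ⟨φᵢ ⊗ φⱼ, K⟩`, and uses Bessel's EQUALITY
`∫∫D² = h − Σ Mᵢⱼ²` («‖𝖪 − P𝖪P‖²_HS = ‖𝖪‖²_HS − ‖M‖²_F» for the orthogonal projection `P` onto `span φ`).  This file
proves that identity for `S = (−t,t)`, `K` continuous, `φ` bounded measurable orthonormal (`integral_sq_remainder_eq`),
and restates the certificate with exactly the certified premises `(h, M, μ₀, δ)`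
(`noUnitEigenvalue_of_galerkin_certificate'`, and the `K_θ = limKernel θ` instance).  RH-FREE; a window certified
this way is an unconditional finite fact about one explicit operator, never evidence for RH.

References: M. Suzuki, J. Funct. Anal. 281 (2021) 109116 = arXiv:1606.05726, §3.4; M. Suzuki, ASPM 84 (2020) =
arXiv:1907.07302, Thm. 1.2.
-/

set_option linter.dupNamespace false

noncomputable section

open MeasureTheory Set

namespace Summit.RiemannHypothesis.RiemannHypothesis.Theorems.SuzukiWindowsDoorGalerkinBessel

open Summit.RiemannHypothesis.RiemannHypothesis.Theorems.SuzukiWindowsDoorGalerkinWindow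
  (noUnitEigenvalue_of_galerkin_certificate)

/-- **Bessel's equality for the Galerkin remainder** (RH-free, K-general).  With `S = (−t,t)`, `K` continuous,
`φ₁,…,φₙ` bounded measurable and orthonormal in `L²(S)`, and `M` THE GALERKIN MATRIX
`Mᵢⱼ = ∫_S φᵢ(x) (∫_S K(x+y) φⱼ(y) dy) dx`, the finite-rank remainder `D(x,y) = K(x+y) − Σᵢⱼ Mᵢⱼ φᵢ(x)φⱼ(y)`
satisfies `∫_S∫_S D² = ∫_S∫_S K(x+y)² − Σᵢⱼ Mᵢⱼ²` («‖𝖪 − P𝖪P‖²_HS = ‖𝖪‖²_HS − ‖M‖²_F»): the identity by which the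
rh-dbr engine evaluates the Hilbert–Schmidt remainder of its certificates. [folklore: Bessel's equality] -/
theorem integral_sq_remainder_eq {K : ℝ → ℝ} (hK : Continuous K) {t : ℝ} {n : ℕ}
    {φ : Fin n → ℝ → ℝ} (hφm : ∀ i, Measurable (φ i)) {B : ℝ} (hφb : ∀ i x, |φ i x| ≤ B)
    (horth : ∀ i j, ∫ x in Ioo (-t) t, φ i x * φ j x = if i = j then 1 else 0)
    (M : Matrix (Fin n) (Fin n) ℝ)
    (hMdef : ∀ i j, M i j = ∫ x in Ioo (-t) t, φ i x * ∫ y in Ioo (-t) t, K (x + y) * φ j y) :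
    ∫ x in Ioo (-t) t, ∫ y in Ioo (-t) t, (K (x + y) - ∑ i, ∑ j, M i j * φ i x * φ j y) ^ 2 =
      (∫ x in Ioo (-t) t, ∫ y in Ioo (-t) t, K (x + y) ^ 2) - ∑ i, ∑ j, M i j ^ 2 := by
  set μ : Measure ℝ := volume.restrict (Ioo (-t) t) with hμ
  haveI : IsFiniteMeasure μ := by
    rw [hμ]; exact isFiniteMeasure_restrict.2 (by rw [Real.volume_Ioo]; exact ENNReal.ofReal_ne_top)
  have hφae : ∀ i, AEStronglyMeasurable (φ i) μ := fun i => (hφm i).aestronglyMeasurable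
  have hφbd : ∀ i, ∀ᵐ x ∂μ, ‖φ i x‖ ≤ B := fun i =>
    Filter.Eventually.of_forall fun x => by rw [Real.norm_eq_abs]; exact hφb i x
  have hφB : ∀ i x, |φ i x| ≤ |B| := fun i x => (hφb i x).trans (le_abs_self B)
  have hφ1 : ∀ i, Integrable (φ i) μ := fun i =>
    (MemLp.of_bound (hφae i) B (hφbd i) : MemLp (φ i) 1 μ).integrable le_rfl
  have hφφ : ∀ i j, Integrable (fun x => φ i x * φ j x) μ := fun i j => (hφ1 j).bdd_mul (hφae i) (hφbd i)
  -- kernel rows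
  have hKL2 : ∀ x, MemLp (fun y => K (x + y)) 2 μ := fun x => SuzukiHSWindow.memLp_two_kernel_row hK t x
  have hK1 : ∀ x, Integrable (fun y => K (x + y)) μ := fun x => (hKL2 x).integrable one_le_two
  have hK2 : ∀ x, Integrable (fun y => K (x + y) ^ 2) μ := fun x => (hKL2 x).integrable_sq
  have hKφ : ∀ x j, Integrable (fun y => K (x + y) * φ j y) μ := fun x j => (hK1 x).mul_bdd (hφae j) (hφbd j)
  -- G j x := ∫ K(x+y) φ_j(y) dy is bounded and measurable in x
  set G : Fin n → ℝ → ℝ := fun j x => ∫ y, K (x + y) * φ j y ∂μ with hG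
  obtain ⟨CK, hCK⟩ := (isCompact_Icc : IsCompact (Icc (-(2 * |t|)) (2 * |t|))).exists_bound_of_continuousOn
    hK.continuousOn
  have hKb : ∀ x ∈ Ioo (-t) t, ∀ y ∈ Ioo (-t) t, ‖K (x + y)‖ ≤ CK := fun x hx y hy =>
    hCK (x + y) ⟨by nlinarith [hx.1, hy.1, le_abs_self t, neg_abs_le t], by nlinarith [hx.2, hy.2, le_abs_self t]⟩
  have hGm : ∀ j, StronglyMeasurable (G j) := by
    intro j
    have hsm : StronglyMeasurable (Function.uncurry fun x y : ℝ => K (x + y) * φ j y) :=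
      ((hK.measurable.comp (measurable_fst.add measurable_snd)).mul ((hφm j).comp measurable_snd)).stronglyMeasurable
    exact hsm.integral_prod_right
  have hGb : ∀ j, ∀ x ∈ Ioo (-t) t, ‖G j x‖ ≤ CK * |B| * volume.real (Ioo (-t) t) := by
    intro j x hx
    exact norm_setIntegral_le_of_norm_le_const (μ := volume) (s := Ioo (-t) t)
      (by rw [Real.volume_Ioo]; exact ENNReal.ofReal_lt_top) (fun y hy => by
        rw [norm_mul, Real.norm_eq_abs, Real.norm_eq_abs]
        exact mul_le_mul (by simpa [Real.norm_eq_abs] using hKb x hx y hy) (hφB j y) (abs_nonneg _)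
          ((norm_nonneg _).trans (hKb x hx y hy)))
  have hGbd : ∀ j, ∀ᵐ x ∂μ, ‖G j x‖ ≤ CK * |B| * volume.real (Ioo (-t) t) := fun j => by
    rw [hμ]; filter_upwards [ae_restrict_mem measurableSet_Ioo] with x hx; exact hGb j x hx
  have hφG : ∀ i j, Integrable (fun x => φ i x * G j x) μ := fun i j =>
    ((MemLp.of_bound (hGm j).aestronglyMeasurable _ (hGbd j) : MemLp (G j) 1 μ).integrable le_rfl).bdd_mul
      (hφae i) (hφbd i)
  have hM' : ∀ i j, M i j = ∫ x, φ i x * G j x ∂μ := fun i j => by rw [hMdef]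
  -- the finite-rank rows
  set CR : ℝ := ∑ i, ∑ j, |M i j| * |B| * |B| with hCR
  have hRm : ∀ x, AEStronglyMeasurable (fun y => ∑ i, ∑ j, M i j * φ i x * φ j y) μ := by
    intro x
    refine Finset.aestronglyMeasurable_fun_sum _ fun i _ => Finset.aestronglyMeasurable_fun_sum _ fun j _ => ?_
    exact (hφae j).const_mul (M i j * φ i x)
  have hRabs : ∀ x y, |∑ i, ∑ j, M i j * φ i x * φ j y| ≤ CR := by
    intro x y
    calc |∑ i, ∑ j, M i j * φ i x * φ j y| ≤ ∑ i, |∑ j, M i j * φ i x * φ j y| :=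
          Finset.abs_sum_le_sum_abs _ _
      _ ≤ ∑ i, ∑ j, |M i j * φ i x * φ j y| :=
          Finset.sum_le_sum fun i _ => Finset.abs_sum_le_sum_abs _ _
      _ ≤ ∑ i, ∑ j, |M i j| * |B| * |B| := by
          refine Finset.sum_le_sum fun i _ => Finset.sum_le_sum fun j _ => ?_
          rw [abs_mul, abs_mul]
          exact mul_le_mul (mul_le_mul_of_nonneg_left (hφB i x) (abs_nonneg _)) (hφB j y)
            (abs_nonneg _) (mul_nonneg (abs_nonneg _) (abs_nonneg _))
  have hRb : ∀ x, ∀ᵐ y ∂μ, ‖∑ i, ∑ j, M i j * φ i x * φ j y‖ ≤ CR := fun x =>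
    Filter.Eventually.of_forall fun y => by rw [Real.norm_eq_abs]; exact hRabs x y
  have hR1 : ∀ x, Integrable (fun y => ∑ i, ∑ j, M i j * φ i x * φ j y) μ := fun x =>
    (MemLp.of_bound (hRm x) CR (hRb x) : MemLp _ 1 μ).integrable le_rfl
  have hKR : ∀ x, Integrable (fun y => K (x + y) * ∑ i, ∑ j, M i j * φ i x * φ j y) μ := fun x =>
    (hK1 x).mul_bdd (hRm x) (hRb x)
  have hRR : ∀ x, Integrable (fun y => (∑ i, ∑ j, M i j * φ i x * φ j y) * ∑ i, ∑ j, M i j * φ i x * φ j y) μ :=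
    fun x => (hR1 x).bdd_mul (hRm x) (hRb x)
  -- inner integrals
  have hinKR : ∀ x, ∫ y, K (x + y) * ∑ i, ∑ j, M i j * φ i x * φ j y ∂μ = ∑ i, ∑ j, M i j * φ i x * G j x := by
    intro x
    have h1 : (fun y => K (x + y) * ∑ i, ∑ j, M i j * φ i x * φ j y) =
        fun y => ∑ i, ∑ j, M i j * φ i x * (K (x + y) * φ j y) := by
      funext y; simp only [Finset.mul_sum]
      exact Finset.sum_congr rfl fun i _ => Finset.sum_congr rfl fun j _ => by ring
    rw [h1, integral_finsetSum _ fun i _ => ?_]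
    · refine Finset.sum_congr rfl fun i _ => ?_
      rw [integral_finsetSum _ fun j _ => (hKφ x j).const_mul _]
      exact Finset.sum_congr rfl fun j _ => by rw [integral_const_mul]
    · exact integrable_finsetSum _ fun j _ => (hKφ x j).const_mul _
  have hinRR : ∀ x, ∫ y, (∑ i, ∑ j, M i j * φ i x * φ j y) * ∑ i, ∑ j, M i j * φ i x * φ j y ∂μ =
      ∑ i, ∑ j, ∑ k, M i j * M k j * (φ i x * φ k x) := by
    intro x
    have h1 : (fun y => (∑ i, ∑ j, M i j * φ i x * φ j y) * ∑ i, ∑ j, M i j * φ i x * φ j y) =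
        fun y => ∑ i, ∑ j, ∑ k, ∑ l, M i j * M k l * (φ i x * φ k x) * (φ j y * φ l y) := by
      funext y
      simp only [Finset.sum_mul, Finset.mul_sum]
      exact Finset.sum_congr rfl fun i _ => Finset.sum_congr rfl fun j _ =>
        Finset.sum_congr rfl fun k _ => Finset.sum_congr rfl fun l _ => by ring
    rw [h1, integral_finsetSum _ fun i _ => ?_]
    · refine Finset.sum_congr rfl fun i _ => ?_
      rw [integral_finsetSum _ fun j _ => ?_]
      · refine Finset.sum_congr rfl fun j _ => ?_
        rw [integral_finsetSum _ fun k _ => ?_]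
        · refine Finset.sum_congr rfl fun k _ => ?_
          rw [integral_finsetSum _ fun l _ => (hφφ j l).const_mul _]
          have : ∀ l, ∫ y, M i j * M k l * (φ i x * φ k x) * (φ j y * φ l y) ∂μ =
              M i j * M k l * (φ i x * φ k x) * (if j = l then 1 else 0) := fun l => by
            rw [integral_const_mul, ← horth j l]
          simp_rw [this]
          simp [Finset.sum_ite_eq]
        · exact integrable_finsetSum _ fun l _ => (hφφ j l).const_mul _
      · exact integrable_finsetSum _ fun k _ => integrable_finsetSum _ fun l _ => (hφφ j l).const_mul _
    · exact integrable_finsetSum _ fun j _ => integrable_finsetSum _ fun k _ =>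
        integrable_finsetSum _ fun l _ => (hφφ j l).const_mul _
  have hsq : ∀ x y, (K (x + y) - ∑ i, ∑ j, M i j * φ i x * φ j y) ^ 2 =
      K (x + y) ^ 2 - 2 * (K (x + y) * ∑ i, ∑ j, M i j * φ i x * φ j y) +
        (∑ i, ∑ j, M i j * φ i x * φ j y) * ∑ i, ∑ j, M i j * φ i x * φ j y := fun x y => by ring
  have hinner : ∀ x, ∫ y, (K (x + y) - ∑ i, ∑ j, M i j * φ i x * φ j y) ^ 2 ∂μ =
      (∫ y, K (x + y) ^ 2 ∂μ) - 2 * ∑ i, ∑ j, M i j * φ i x * G j x +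
        ∑ i, ∑ j, ∑ k, M i j * M k j * (φ i x * φ k x) := by
    intro x
    simp_rw [hsq x]
    rw [integral_add, integral_sub, integral_const_mul, hinKR x, hinRR x]
    all_goals first
      | exact hK2 x
      | exact hRR x
      | exact (hKR x).const_mul 2
      | exact (hK2 x).sub ((hKR x).const_mul 2)
  -- outer integral
  have hI2 : Integrable (fun x => ∫ y, K (x + y) ^ 2 ∂μ) μ := by
    have hsm : StronglyMeasurable (Function.uncurry fun x y : ℝ => K (x + y) ^ 2) :=
      ((hK.measurable.comp (measurable_fst.add measurable_snd)).pow_const 2).stronglyMeasurable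
    have hmeas : StronglyMeasurable fun x : ℝ => ∫ y in Ioo (-t) t, K (x + y) ^ 2 := hsm.integral_prod_right
    refine Integrable.mono' (integrable_const (CK ^ 2 * volume.real (Ioo (-t) t))) hmeas.aestronglyMeasurable ?_
    rw [hμ]; filter_upwards [ae_restrict_mem measurableSet_Ioo] with x hx
    refine norm_setIntegral_le_of_norm_le_const (μ := volume) (s := Ioo (-t) t)
      (by rw [Real.volume_Ioo]; exact ENNReal.ofReal_lt_top) (fun y hy => ?_)
    rw [norm_pow]
    exact pow_le_pow_left₀ (norm_nonneg _) (hKb x hx y hy) 2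
  have hIb : Integrable (fun x => 2 * ∑ i, ∑ j, M i j * φ i x * G j x) μ := by
    have : Integrable (fun x => ∑ i, ∑ j, (2 * M i j) * (φ i x * G j x)) μ :=
      integrable_finsetSum _ fun i _ => integrable_finsetSum _ fun j _ => (hφG i j).const_mul _
    refine this.congr (Filter.Eventually.of_forall fun x => ?_)
    simp only [Finset.mul_sum]
    exact Finset.sum_congr rfl fun i _ => Finset.sum_congr rfl fun j _ => by ring
  have hIc : Integrable (fun x => ∑ i, ∑ j, ∑ k, M i j * M k j * (φ i x * φ k x)) μ :=
    integrable_finsetSum _ fun i _ => integrable_finsetSum _ fun j _ =>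
      integrable_finsetSum _ fun k _ => (hφφ i k).const_mul _
  have hOb : ∫ x, 2 * ∑ i, ∑ j, M i j * φ i x * G j x ∂μ = 2 * ∑ i, ∑ j, M i j ^ 2 := by
    have h1 : (fun x => 2 * ∑ i, ∑ j, M i j * φ i x * G j x) = fun x => ∑ i, ∑ j, (2 * M i j) * (φ i x * G j x) := by
      funext x; simp only [Finset.mul_sum]
      exact Finset.sum_congr rfl fun i _ => Finset.sum_congr rfl fun j _ => by ring
    rw [h1, integral_finsetSum _ fun i _ => ?_, Finset.mul_sum]
    · refine Finset.sum_congr rfl fun i _ => ?_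
      rw [integral_finsetSum _ fun j _ => (hφG i j).const_mul _, Finset.mul_sum]
      refine Finset.sum_congr rfl fun j _ => ?_
      rw [integral_const_mul, ← hM' i j]; ring
    · exact integrable_finsetSum _ fun j _ => (hφG i j).const_mul _
  have hOc : ∫ x, ∑ i, ∑ j, ∑ k, M i j * M k j * (φ i x * φ k x) ∂μ = ∑ i, ∑ j, M i j ^ 2 := by
    rw [integral_finsetSum _ fun i _ => ?_]
    · refine Finset.sum_congr rfl fun i _ => ?_
      rw [integral_finsetSum _ fun j _ => ?_]
      · refine Finset.sum_congr rfl fun j _ => ?_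
        rw [integral_finsetSum _ fun k _ => (hφφ i k).const_mul _]
        have : ∀ k, ∫ x, M i j * M k j * (φ i x * φ k x) ∂μ = M i j * M k j * (if i = k then 1 else 0) :=
          fun k => by rw [integral_const_mul, ← horth i k]
        simp_rw [this]
        simp [Finset.sum_ite_eq, sq]
      · exact integrable_finsetSum _ fun k _ => (hφφ i k).const_mul _
    · exact integrable_finsetSum _ fun j _ => integrable_finsetSum _ fun k _ => (hφφ i k).const_mul _
  simp_rw [hinner]
  rw [integral_add, integral_sub, hOb, hOc]
  · ring
  all_goals first
    | exact hI2
    | exact hIb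
    | exact hIc
    | exact hI2.sub hIb

/-- **Galerkin window certificate, as certified** (RH-free, K-general): the form in which the rh-dbr engine's
numbers enter — `h ≥ ∫_S∫_S K(x+y)²` (Hilbert–Schmidt integral), `M` the Galerkin matrix of `K` in the
orthonormal family `φ` (entries as iterated integrals), `μ₀ ≥` the quadratic-form norm of `M`, and
`δ² ≥ h − Σᵢⱼ Mᵢⱼ²` with `δ > 0`; if `μ₀ + δ < 1` then `NoUnitEigenvalue K t`.
[cite: Suzuki2021Hamiltonians, §3.4; folklore: Bessel's equality] -/
theorem noUnitEigenvalue_of_galerkin_certificate' {K : ℝ → ℝ} (hK : Continuous K) {t : ℝ} {n : ℕ}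
    {φ : Fin n → ℝ → ℝ} (hφm : ∀ i, Measurable (φ i)) {B : ℝ} (hφb : ∀ i x, |φ i x| ≤ B)
    (horth : ∀ i j, ∫ x in Ioo (-t) t, φ i x * φ j x = if i = j then 1 else 0)
    (M : Matrix (Fin n) (Fin n) ℝ)
    (hMdef : ∀ i j, M i j = ∫ x in Ioo (-t) t, φ i x * ∫ y in Ioo (-t) t, K (x + y) * φ j y)
    {h μ₀ δ : ℝ} (hh : ∫ x in Ioo (-t) t, ∫ y in Ioo (-t) t, K (x + y) ^ 2 ≤ h) (hμ₀ : 0 ≤ μ₀) (hδ : 0 < δ)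
    (hM : ∀ c : Fin n → ℝ, |∑ i, ∑ j, c i * M i j * c j| ≤ μ₀ * ∑ i, c i ^ 2)
    (hrem : h - ∑ i, ∑ j, M i j ^ 2 ≤ δ ^ 2) (hΛ : μ₀ + δ < 1) :
    Literature.NumberTheory.LFunctions.NoUnitEigenvalue K t := by
  refine noUnitEigenvalue_of_galerkin_certificate hK hφm hφb horth M hμ₀ hδ hM ?_ hΛ
  rw [integral_sq_remainder_eq hK hφm hφb horth M hMdef]
  linarith


/-- **Instance for Suzuki's single operator, as certified** (RH-free): for `θ > 1`, `K_θ = limKernel θ`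
(continuous by `Suzuki2020_thm12_continuous`), an orthonormal bounded measurable family `φ` on `(−t,t)`, the
Galerkin matrix `M` of `K_θ` in `φ`, and certified numbers `h ≥ ∫∫K_θ(x+y)²`, `μ₀ ≥` the quadratic-form norm of
`M`, `δ² ≥ h − Σ Mᵢⱼ²` with `μ₀ + δ < 1`: `NoUnitEigenvalue (limKernel θ) t`.  These are literally the premises the
cell rh-dbr certifies by interval arithmetic (DATA.md §ET1b/§ET1c: θ = 12, t ≤ 1.4; θ = 20, t ≤ 1.5, two
lineages); such an instance is an unconditional finite fact, never evidence for RH.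
[cite: Suzuki2020IntegralOperators, Thm. 1.2 (K-v)] -/
theorem noUnitEigenvalue_limKernel_of_galerkin_certificate' {θ t : ℝ} (hθ : 1 < θ) {n : ℕ}
    {φ : Fin n → ℝ → ℝ} (hφm : ∀ i, Measurable (φ i)) {B : ℝ} (hφb : ∀ i x, |φ i x| ≤ B)
    (horth : ∀ i j, ∫ x in Ioo (-t) t, φ i x * φ j x = if i = j then 1 else 0)
    (M : Matrix (Fin n) (Fin n) ℝ)
    (hMdef : ∀ i j, M i j = ∫ x in Ioo (-t) t, φ i x *
      ∫ y in Ioo (-t) t, Literature.NumberTheory.LFunctions.limKernel θ (x + y) * φ j y)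
    {h μ₀ δ : ℝ}
    (hh : ∫ x in Ioo (-t) t, ∫ y in Ioo (-t) t, (Literature.NumberTheory.LFunctions.limKernel θ (x + y)) ^ 2 ≤ h)
    (hμ₀ : 0 ≤ μ₀) (hδ : 0 < δ)
    (hM : ∀ c : Fin n → ℝ, |∑ i, ∑ j, c i * M i j * c j| ≤ μ₀ * ∑ i, c i ^ 2)
    (hrem : h - ∑ i, ∑ j, M i j ^ 2 ≤ δ ^ 2) (hΛ : μ₀ + δ < 1) :
    Literature.NumberTheory.LFunctions.NoUnitEigenvalue (Literature.NumberTheory.LFunctions.limKernel θ) t :=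
  noUnitEigenvalue_of_galerkin_certificate'
    (Literature.NumberTheory.LFunctions.Suzuki2020_thm12_continuous hθ) hφm hφb horth M hMdef hh hμ₀ hδ hM hrem hΛ

end Summit.RiemannHypothesis.RiemannHypothesis.Theorems.SuzukiWindowsDoorGalerkinBessel

end
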